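import Summits.QuantumFields.YangMills.Theorems.FemtoTransferGapRungW1upAlgebra
import HarnessLib

/-!
# The adjoint Polyakov deviation is Lipschitz RELATIVE TO ITS OWN SIZE (derivative-free «adjoint gradient identity»)
# — support for `AdjointLoopFano.AdjointLoopDirichlet` (item stmt-QuantumFields-23322)

Route `AdjointLoopFano` (D-0145 LINE g16-B of seat ym-idea-4).  The planner's layer-2 stub «AdjointGradientIdentity»
(`|∂_ℓ Re tr P|² ≤ 4 − (Re tr P)²` along every left-invariant direction on `SU(2)`, whence `|∂ d|² ≤ 16 d` for `d = 4 − (Re tr)²`)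
in a FINITE-DIFFERENCE form that needs no calculus on the group and carries NO second-order remainder:

  ★ `adjDev_sub_sq_le`:  `(d(P) − d(Q))² ≤ 4 · (d(P) + d(Q)) · ‖P − Q‖_F²`   for all `P, Q ∈ SU(2)`, `d(X) = 4 − (Re tr X)²`.

(With eigen-angles `Re tr P = 2cos a`, `Re tr Q = 2cos b`: `d(P) − d(Q) = 4 sin(a+b) sin(a−b)`, `sin²(a+b) ≤ 2(sin²a + sin²b)`, and
`‖P − Q‖_F² = 4 − 2Re tr(PQ⁻¹) ≥ 4 − 4cos(a − b)` — the last step is the KEY trace inequality `two_mul_re_trace_mul_inv_le`: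
`2 Re tr(PQ⁻¹) ≤ Re tr P · Re tr Q + √(4 − (Re tr P)²)·√(4 − (Re tr Q)²)`, proved coordinate-free by splitting `P = (Re tr P/2)·1 + A`
with `A` trace-free-in-real-part, `‖A‖_F² = (4 − (Re tr P)²)/2`, and Cauchy–Schwarz for the Frobenius pairing.)

HONEST FRAMING: pure `SU(2)` matrix algebra; the crux `AdjointLoopDirichlet` is OPEN; nothing here bears on infinite volume or the Clay gap;
the YM mass gap is NOT proved.  No `sorry`, no new axiom, no new definition.
References: [cite: HornJohnson2013, (0.2.5)]; [cite: Luscher1983, §2].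
-/

set_option autoImplicit false

noncomputable section

open scoped Matrix ComplexConjugate
open Literature.MathematicalPhysics.QuantumFieldTheory (frobNorm frobNorm_nonneg frobNorm_sq_eq_re_trace)
open Literature.MathematicalPhysics.QuantumLattice (fundamentalRep_apply)

namespace Summit.QuantumFields.YangMills.Theorems.AdjointLoopFano

open Summit.QuantumFields.YangMills.Theorems.FemtoTransferGap

/-! ## §1 Cauchy–Schwarz for the Frobenius pairing on `2 × 2` complex matrices -/

/-- Polarisation with a real parameter: `‖A + c·B‖_F² = ‖A‖_F² + 2c·Re tr(Aᴴ B) + c²‖B‖_F²`. [cite: HornJohnson2013, (0.2.5)] -/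
theorem frobNorm_add_real_smul_sq (A B : Matrix (Fin 2) (Fin 2) ℂ) (c : ℝ) :
    frobNorm (A + (c : ℂ) • B) ^ 2 = frobNorm A ^ 2 + 2 * c * (Aᴴ * B).trace.re + c ^ 2 * frobNorm B ^ 2 := by
  have hBA : (Bᴴ * A).trace.re = (Aᴴ * B).trace.re := by
    have h : Bᴴ * A = (Aᴴ * B)ᴴ := by rw [Matrix.conjTranspose_mul, Matrix.conjTranspose_conjTranspose]
    rw [h, Matrix.trace_conjTranspose, Complex.star_def, Complex.conj_re]
  rw [frobNorm_sq_eq_re_trace, frobNorm_sq_eq_re_trace, frobNorm_sq_eq_re_trace]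
  have hc : star (c : ℂ) = (c : ℂ) := Complex.conj_ofReal c
  rw [Matrix.conjTranspose_add, Matrix.conjTranspose_smul, hc]
  simp only [Matrix.add_mul, Matrix.mul_add, Matrix.smul_mul, Matrix.mul_smul, Matrix.trace_add, Matrix.trace_smul,
    smul_eq_mul, Complex.add_re, Complex.mul_re, Complex.ofReal_re, Complex.ofReal_im, zero_mul, sub_zero, hBA]
  ring

/-- **Cauchy–Schwarz**: `Re tr(Aᴴ B) ≤ ‖A‖_F ‖B‖_F` (discriminant of `c ↦ ‖A − cB‖_F² ≥ 0`). [cite: HornJohnson2013, (0.2.5)] -/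
theorem re_trace_conjTranspose_mul_le (A B : Matrix (Fin 2) (Fin 2) ℂ) :
    (Aᴴ * B).trace.re ≤ frobNorm A * frobNorm B := by
  have hquad : ∀ c : ℝ, 0 ≤ frobNorm B ^ 2 * (c * c) + (-(2 * (Aᴴ * B).trace.re)) * c + frobNorm A ^ 2 := by
    intro c
    have h0 : 0 ≤ frobNorm (A + ((-c : ℝ) : ℂ) • B) ^ 2 := sq_nonneg _
    rw [frobNorm_add_real_smul_sq] at h0
    nlinarith [h0]
  have hd := discrim_le_zero hquad
  rw [discrim] at hd
  have hA := frobNorm_nonneg A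
  have hB := frobNorm_nonneg B
  nlinarith [hd, mul_nonneg hA hB]

/-- `Re tr(A Bᴴ) ≤ ‖A‖_F ‖B‖_F`. [cite: HornJohnson2013, (0.2.5)] -/
theorem re_trace_mul_conjTranspose_le (A B : Matrix (Fin 2) (Fin 2) ℂ) :
    (A * Bᴴ).trace.re ≤ frobNorm A * frobNorm B := by
  have h := re_trace_conjTranspose_mul_le B A
  rw [Matrix.trace_mul_comm, mul_comm (frobNorm A)]
  exact h

/-! ## §2 The scalar–traceless split of an `SU(2)` matrix -/

/-- For `P ∈ SU(2)` with `x = Re tr P`: `‖P − (x/2)·1‖_F² = (4 − x²)/2`. [cite: HornJohnson2013, (0.2.5)] -/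
theorem frobNorm_sub_half_trace_sq (P : SU2) :
    frobNorm ((P : Matrix (Fin 2) (Fin 2) ℂ) - ((((P : Matrix (Fin 2) (Fin 2) ℂ).trace.re / 2 : ℝ) : ℂ)) • 1) ^ 2 =
      (4 - ((P : Matrix (Fin 2) (Fin 2) ℂ).trace.re) ^ 2) / 2 := by
  set M : Matrix (Fin 2) (Fin 2) ℂ := (P : Matrix (Fin 2) (Fin 2) ℂ) with hM
  set x : ℝ := (M.trace).re with hx
  have hU : Mᴴ * M = 1 := by
    rw [← Matrix.star_eq_conjTranspose]; exact Matrix.mem_unitaryGroup_iff'.1 (su2_mem_unitaryGroup P)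
  have hc : star ((x / 2 : ℝ) : ℂ) = ((x / 2 : ℝ) : ℂ) := Complex.conj_ofReal _
  have htrH : (Mᴴ.trace).re = x := by
    rw [Matrix.trace_conjTranspose, Complex.star_def, Complex.conj_re]
  have h2 : ((1 : Matrix (Fin 2) (Fin 2) ℂ).trace).re = 2 := by
    rw [Matrix.trace_one]; simp
  rw [frobNorm_sq_eq_re_trace, Matrix.conjTranspose_sub, Matrix.conjTranspose_smul, hc, Matrix.conjTranspose_one]
  simp only [Matrix.sub_mul, Matrix.mul_sub, Matrix.smul_mul, Matrix.mul_smul, Matrix.one_mul, Matrix.mul_one, hU,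
    Matrix.trace_sub, Matrix.trace_smul, smul_eq_mul, Complex.sub_re, Complex.mul_re, Complex.ofReal_re,
    Complex.ofReal_im, zero_mul, sub_zero, htrH, h2, ← hx]
  ring

/-- The real part of the trace of the traceless part vanishes: `Re tr(P − (x/2)·1) = 0`. [folklore] -/
theorem re_trace_sub_half_trace (P : SU2) :
    (((P : Matrix (Fin 2) (Fin 2) ℂ) - ((((P : Matrix (Fin 2) (Fin 2) ℂ).trace.re / 2 : ℝ) : ℂ)) • 1).trace).re = 0 := by
  rw [Matrix.trace_sub, Matrix.trace_smul, Matrix.trace_one, smul_eq_mul]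
  simp
  
/-! ## §3 The KEY trace inequality and the Frobenius distance -/

/-- ★ **KEY**: `2 Re tr(P Q⁻¹) ≤ Re tr P · Re tr Q + √(4 − (Re tr P)²) · √(4 − (Re tr Q)²)` on `SU(2)`
(eigen-angle form: `cos θ(PQ⁻¹) ≤ cos(a − b)`). [cite: HornJohnson2013, (0.2.5)] -/
theorem two_mul_re_trace_mul_inv_le (P Q : SU2) :
    2 * (((P * Q⁻¹ : SU2) : Matrix (Fin 2) (Fin 2) ℂ).trace).re ≤
      ((P : Matrix (Fin 2) (Fin 2) ℂ).trace).re * ((Q : Matrix (Fin 2) (Fin 2) ℂ).trace).re +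
        Real.sqrt (4 - ((P : Matrix (Fin 2) (Fin 2) ℂ).trace.re) ^ 2) *
          Real.sqrt (4 - ((Q : Matrix (Fin 2) (Fin 2) ℂ).trace.re) ^ 2) := by
  set M : Matrix (Fin 2) (Fin 2) ℂ := (P : Matrix (Fin 2) (Fin 2) ℂ) with hM
  set N : Matrix (Fin 2) (Fin 2) ℂ := (Q : Matrix (Fin 2) (Fin 2) ℂ) with hN
  set x : ℝ := (M.trace).re with hx
  set y : ℝ := (N.trace).re with hy
  set A : Matrix (Fin 2) (Fin 2) ℂ := M - (((x / 2 : ℝ)) : ℂ) • 1 with hA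
  set B : Matrix (Fin 2) (Fin 2) ℂ := N - (((y / 2 : ℝ)) : ℂ) • 1 with hB
  -- `P Q⁻¹ = M Nᴴ`
  have hPQ : ((P * Q⁻¹ : SU2) : Matrix (Fin 2) (Fin 2) ℂ) = M * Nᴴ := by
    rw [← Matrix.star_eq_inv, Submonoid.coe_mul, Matrix.specialUnitaryGroup.coe_star, Matrix.star_eq_conjTranspose]
  -- expand `M Nᴴ = (A + (x/2)1)(B + (y/2)1)ᴴ`
  have hMA : M = A + (((x / 2 : ℝ)) : ℂ) • 1 := by rw [hA]; abel
  have hNB : N = B + (((y / 2 : ℝ)) : ℂ) • 1 := by rw [hB]; abel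
  have hcy : star (((y / 2 : ℝ)) : ℂ) = (((y / 2 : ℝ)) : ℂ) := Complex.conj_ofReal _
  have hA0 : (A.trace).re = 0 := re_trace_sub_half_trace P
  have hB0 : (Bᴴ.trace).re = 0 := by
    rw [Matrix.trace_conjTranspose, Complex.star_def, Complex.conj_re]; exact re_trace_sub_half_trace Q
  have h2 : ((1 : Matrix (Fin 2) (Fin 2) ℂ).trace).re = 2 := by rw [Matrix.trace_one]; simp
  have hexp : ((M * Nᴴ).trace).re = (A * Bᴴ).trace.re + x * y / 2 := by
    rw [hMA, hNB, Matrix.conjTranspose_add, Matrix.conjTranspose_smul, hcy, Matrix.conjTranspose_one]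
    simp only [Matrix.add_mul, Matrix.mul_add, Matrix.smul_mul, Matrix.mul_smul, Matrix.one_mul, Matrix.mul_one,
      Matrix.trace_add, Matrix.trace_smul, smul_eq_mul, Complex.add_re, Complex.mul_re, Complex.ofReal_re,
      Complex.ofReal_im, zero_mul, sub_zero, hA0, hB0, h2]
    ring
  -- Cauchy–Schwarz and the norms of `A`, `B`
  have hCS : (A * Bᴴ).trace.re ≤ frobNorm A * frobNorm B := re_trace_mul_conjTranspose_le A B
  have hAsq : frobNorm A ^ 2 = (4 - x ^ 2) / 2 := frobNorm_sub_half_trace_sq P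
  have hBsq : frobNorm B ^ 2 = (4 - y ^ 2) / 2 := frobNorm_sub_half_trace_sq Q
  have hAeq : frobNorm A = Real.sqrt ((4 - x ^ 2) / 2) := by
    rw [← hAsq, Real.sqrt_sq (frobNorm_nonneg _)]
  have hBeq : frobNorm B = Real.sqrt ((4 - y ^ 2) / 2) := by
    rw [← hBsq, Real.sqrt_sq (frobNorm_nonneg _)]
  have hx2 : 0 ≤ 4 - x ^ 2 := by have := frobNorm_nonneg A; nlinarith [hAsq]
  have hy2 : 0 ≤ 4 - y ^ 2 := by have := frobNorm_nonneg B; nlinarith [hBsq]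
  have hprod : frobNorm A * frobNorm B = Real.sqrt (4 - x ^ 2) * Real.sqrt (4 - y ^ 2) / 2 := by
    rw [hAeq, hBeq, ← Real.sqrt_mul (by positivity), ← Real.sqrt_mul hx2]
    have : (4 - x ^ 2) / 2 * ((4 - y ^ 2) / 2) = (4 - x ^ 2) * (4 - y ^ 2) / 4 := by ring
    rw [this, Real.sqrt_div (mul_nonneg hx2 hy2), show Real.sqrt 4 = 2 by
      rw [show (4 : ℝ) = 2 ^ 2 by norm_num, Real.sqrt_sq (by norm_num)]]
  rw [hPQ, hexp]
  nlinarith [hCS, hprod]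

/-- `‖P − Q‖_F² = 4 − 2 Re tr(PQ⁻¹)` on `SU(2)`. [cite: HornJohnson2013, (0.2.5)] -/
theorem frobNorm_sub_sq_eq (P Q : SU2) :
    frobNorm ((P : Matrix (Fin 2) (Fin 2) ℂ) - (Q : Matrix (Fin 2) (Fin 2) ℂ)) ^ 2 =
      4 - 2 * (((P * Q⁻¹ : SU2) : Matrix (Fin 2) (Fin 2) ℂ).trace).re := by
  rw [frobNorm_sub_eq_mul_inv, frobNorm_sub_one_sq]

/-! ## §4 The relative Lipschitz bound of the adjoint deviation -/

/-- ★★ **Adjoint deviation, relative Lipschitz bound**: with `d(X) = 4 − (Re tr X)²`,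
`(d(P) − d(Q))² ≤ 4·(d(P) + d(Q))·‖P − Q‖_F²` for all `P, Q ∈ SU(2)` — the finite-difference form of `|∂d|² ≤ 16 d`, with no remainder.
[cite: Luscher1983, §2] [cite: HornJohnson2013, (0.2.5)] -/
theorem adjDev_sub_sq_le (P Q : SU2) :
    ((4 - ((P : Matrix (Fin 2) (Fin 2) ℂ).trace.re) ^ 2) - (4 - ((Q : Matrix (Fin 2) (Fin 2) ℂ).trace.re) ^ 2)) ^ 2 ≤
      4 * ((4 - ((P : Matrix (Fin 2) (Fin 2) ℂ).trace.re) ^ 2) + (4 - ((Q : Matrix (Fin 2) (Fin 2) ℂ).trace.re) ^ 2)) *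
        frobNorm ((P : Matrix (Fin 2) (Fin 2) ℂ) - (Q : Matrix (Fin 2) (Fin 2) ℂ)) ^ 2 := by
  set x : ℝ := ((P : Matrix (Fin 2) (Fin 2) ℂ).trace).re with hx
  set y : ℝ := ((Q : Matrix (Fin 2) (Fin 2) ℂ).trace).re with hy
  set F : ℝ := frobNorm ((P : Matrix (Fin 2) (Fin 2) ℂ) - (Q : Matrix (Fin 2) (Fin 2) ℂ)) ^ 2 with hF
  have hkey := two_mul_re_trace_mul_inv_le P Q
  have hFeq := frobNorm_sub_sq_eq P Q
  rw [← hx, ← hy] at hkey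
  rw [← hF] at hFeq
  have hx2 : 0 ≤ 4 - x ^ 2 := by
    have h1 := re_trace_le_two P; have h2 := neg_two_le_re_trace P; rw [← hx] at h1 h2; nlinarith
  have hy2 : 0 ≤ 4 - y ^ 2 := by
    have h1 := re_trace_le_two Q; have h2 := neg_two_le_re_trace Q; rw [← hy] at h1 h2; nlinarith
  set s : ℝ := Real.sqrt (4 - x ^ 2) with hs
  set t : ℝ := Real.sqrt (4 - y ^ 2) with ht
  have hs0 : 0 ≤ s := Real.sqrt_nonneg _
  have ht0 : 0 ≤ t := Real.sqrt_nonneg _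
  have hss : s ^ 2 = 4 - x ^ 2 := Real.sq_sqrt hx2
  have htt : t ^ 2 = 4 - y ^ 2 := Real.sq_sqrt hy2
  -- `F ≥ 4 − xy − st`
  have hF1 : 4 - x * y - s * t ≤ F := by linarith
  -- `(s − t)² ≤ 2F`  (⟸ `(x − y)² ≥ 0`)
  have hF2 : (s - t) ^ 2 ≤ 2 * F := by nlinarith [sq_nonneg (x - y)]
  -- `(s + t)² ≤ 2(s² + t²)`
  have hst : (s + t) ^ 2 ≤ 2 * (s ^ 2 + t ^ 2) := by nlinarith [sq_nonneg (s - t)]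
  have hF0 : 0 ≤ F := by rw [hF]; positivity
  -- `(s² − t²)² = (s−t)²(s+t)² ≤ 2F · 2(s²+t²)`
  have hmain : (s ^ 2 - t ^ 2) ^ 2 ≤ 4 * (s ^ 2 + t ^ 2) * F := by
    have h1 : (s ^ 2 - t ^ 2) ^ 2 = (s - t) ^ 2 * (s + t) ^ 2 := by ring
    rw [h1]
    calc (s - t) ^ 2 * (s + t) ^ 2 ≤ (2 * F) * (2 * (s ^ 2 + t ^ 2)) :=
          mul_le_mul hF2 hst (sq_nonneg _) (by positivity)
      _ = 4 * (s ^ 2 + t ^ 2) * F := by ring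
  rw [← hss, ← htt]
  nlinarith [hmain]

end Summit.QuantumFields.YangMills.Theorems.AdjointLoopFano

end
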